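import Summits.QuantumFields.BalabanUV.Beta.GAN24.OffDiagSandwichFlat

/-!
# `BalabanUV.Beta.GAN24.OffDiagSandwich` — binder row G-an2-4 / (CONV-C), S-slot, road «S3-Taylor» (gan24-p1 `SKELETON-S3.md` v1.1 §16,
# rows Vt / V / V0): THE OFF-DIAGONAL SANDWICH ENGINE, part 2 — THREE BLOCK-DECAYING LEGS × A FINITE-MASS, FINITE-RANGE TABLE × THE BLOCK
# AVERAGE OVER THE VERTEX LOCATION ⇒ A `BiLoc`-SHAPED BOUND WITH AN EXPLICIT, `N`-FREE CONSTANT (`abs_channel_le_col`, `abs_channel_le_row`)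

NOT IN PRINT; OUR BOOKKEEPING (engine of the G-an2-4 swarm leaf seat `b2b-balaban-gan24-formalise-leaf-14`, gen 18, holder of SHAPE row V by
INTENT «ROW-V*», journal l.4689; part 1 = `GAN24/OffDiagSandwichFlat`).  HONEST FRAMING (cell contract, verbatim): «discharging `BetaPertH` makes
Bałaban's UV stability UNCONDITIONAL — a real constructive-QFT result; it is NOT the continuum limit and NOT the Clay problem.»  HONEST DEPENDENCY
(verbatim): «continuum YM on T⁴ ⇐ BetaPertH ∧ nine spine estimates (0/9 proved); BetaPertH ⇐ (D1) ∧ (D4) ∧ CAP+tail; G-an2-4 gates asym, D1 and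
NE2/3/4.»  [folklore] real analysis on `ℤ^D` over W4 `GAN24/TaylorBlockSum` BY NAME (`exp_quo_transfer`, `summable_blockSum_exp`, `blockSum_exp_le`):
cites nothing, mints no `def`, no `def … : Prop`, uses no object of an1/an2/an3, instantiates no wall binder.  Discharges NOTHING of row V, of
«E3Shape»/«E3SupRate», of (hS, hSall); NOT BetaPertH, NOT continuum, NOT Clay.

## What is proved (all [folklore]; `D` the dimension, `N ≥ 1` the blocking, `ι` a finite non-empty fibre-index type, `quo N` = `LatticeForm.quo`)
§3 `reorder_col` / `reorder_row`: finite sums commute — from the literal nesting `(y, l′, w, l, k, u)` of the flat sums of part 1 to the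
   canonical orders `(l′, l, k, u, w, y)` (mass variable `y` innermost) and `(l, l′, k, u, y, w)` (mass variable `w` innermost).
§4 `sum_mass_leg_le` (MASS STEP: `Σ_q |T|·|leg(q)| ≤ 𝟙[|p − u|₁ ≤ r₁] · mT · Ck e^{κ(r₂/N + D)} e^{−κ|quo u − xk|₁}` — the leg at the mass site
   transferred to the vertex location by `exp_quo_transfer`), `sum_count_leg_le` (COUNT STEP: `Σ_p |leg(p)|·𝟙[|p − u|₁ ≤ r₁] ≤ Ca e^{κ(r₁/N + D)}
   e^{−κ|quo u − xa|₁} (2r₁+1)^D`), **`core_bound`** (canonical order; the `u`-level is W4's three-leg block sum `blockSum_exp_le`):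
   flat sum `≤ (#ι)³ · Ca·CB·Ck·mT · (2r₁+1)^D · e^{κ((r₁+r₂)/N + 2D)} · Zl_D(κ/2) · e^{−(κ/2)(|xa − u′|₁ + |xk − u′|₁)}`, uniformly in the site sets.
§5 **`abs_channel_le_col`** (table of finite `y`-MASS, ranges `r₁` in `w − u`, `r₂` in `y − u`) and **`abs_channel_le_row`** (finite `w`-MASS,
   ranges `r₂` in `w − u`, `r₁` in `y − u`): the literally nested channel
   `|Σ'_y Σ_{l′} (Σ'_w Σ_l A_l(w) · Σ_k N^{−D} · Σ'_u B_k(u) · T_k(u; w, y)_{l l′}) · K_{l′}(y)|`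
   `≤ (#ι)³ · Ca·CB·Ck·mT · (2r₁+1)^D · e^{κ((r₁+r₂)/N + 2D)} · Zl_D(κ/2) · e^{−(κ/2)(|xA − u′|₁ + |xK − u′|₁)}`
   for legs `|A_l(w)| ≤ Ca e^{−κ|quo_N w − xA|₁}`, `|B_k(u)| ≤ CB e^{−κ|quo_N u − u′|₁}`, `|K_{l′}(y)| ≤ Ck e^{−κ|quo_N y − xK|₁}` — the
   `BiLoc … u′ u′ _ (κ/2)` shape of `LocStencil` in the read-out variables; the blocking enters ONLY through `(r₁+r₂)/N` (for the pushed
   border increment of row V, `r₁ = R_V·M`, `r₂ = R_V·M + 2D·N`, `mT = Lc^k·(2R_V+1)^D·M·3ℓ²/M^D` — VH1 — so `(2r₁+1)^D·mT = O(Lc^k·M)` and the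
   row's residual `N^{−2}·M` makes the piece `O(Lc^{−2}·Lc^{−k})`: the owner's §16 count, to be instantiated in the row-V file).
-/

noncomputable section

open Finset
open scoped BigOperators
open Literature.MathematicalPhysics.QuantumFieldTheory
open Literature.MathematicalPhysics.QuantumFieldTheory.Balaban1983to89
open Literature.MathematicalPhysics.QuantumFieldTheory.Balaban1983to89.Beta
open B12Sec2to5 (l1 l1_nonneg)
open ExpKernelCalculus (Zl Zl_pos l1_sub_triangle l1_sub_symm)
open LatticeForm (quo)
open Summit.QuantumFields.BalabanUV.Beta.GAN24.TaylorBlockSum (exp_quo_transfer summable_blockSum_exp blockSum_exp_le)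
open Summit.QuantumFields.BalabanUV.Beta.GAN24.OffDiagSandwichFlat (card_filter_l1_le abs_channel_le_of_finset_bound)

namespace Summit.QuantumFields.BalabanUV.Beta.GAN24.OffDiagSandwich

variable {D : ℕ}

/-! ## §3 Reordering the flat sums (finite sums commute) -/

section Reorder

variable {ι : Type*} [Fintype ι] {S : Type*}

/-- [folklore] From the literal nesting `(y, l′, w, l, k, u)` to the order `(l′, l, k, u, w, y)` (mass variable `y` innermost). -/
theorem reorder_col (U W Y : Finset S) (f : ι → ι → ι → S → S → S → ℝ) :
    ∑ y ∈ Y, ∑ l', ∑ w ∈ W, ∑ l, ∑ k, ∑ u ∈ U, f l' l k u w y =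
      ∑ l', ∑ l, ∑ k, ∑ u ∈ U, ∑ w ∈ W, ∑ y ∈ Y, f l' l k u w y := by
  rw [Finset.sum_comm]
  refine Finset.sum_congr rfl fun l' _ => ?_
  trans ∑ w ∈ W, ∑ l, ∑ k, ∑ u ∈ U, ∑ y ∈ Y, f l' l k u w y
  · rw [Finset.sum_comm]
    refine Finset.sum_congr rfl fun w _ => ?_
    rw [Finset.sum_comm]
    refine Finset.sum_congr rfl fun l _ => ?_
    rw [Finset.sum_comm]
    refine Finset.sum_congr rfl fun k _ => ?_
    rw [Finset.sum_comm]
  · rw [Finset.sum_comm]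
    refine Finset.sum_congr rfl fun l _ => ?_
    rw [Finset.sum_comm]
    refine Finset.sum_congr rfl fun k _ => ?_
    rw [Finset.sum_comm]

/-- [folklore] From the literal nesting `(y, l′, w, l, k, u)` to the order `(l, l′, k, u, y, w)` (mass variable `w` innermost). -/
theorem reorder_row (U W Y : Finset S) (f : ι → ι → ι → S → S → S → ℝ) :
    ∑ y ∈ Y, ∑ l', ∑ w ∈ W, ∑ l, ∑ k, ∑ u ∈ U, f l' l k u w y =
      ∑ l, ∑ l', ∑ k, ∑ u ∈ U, ∑ y ∈ Y, ∑ w ∈ W, f l' l k u w y := by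
  trans ∑ y ∈ Y, ∑ l', ∑ l, ∑ k, ∑ u ∈ U, ∑ w ∈ W, f l' l k u w y
  · refine Finset.sum_congr rfl fun y _ => Finset.sum_congr rfl fun l' _ => ?_
    rw [Finset.sum_comm]
    refine Finset.sum_congr rfl fun l _ => ?_
    rw [Finset.sum_comm]
    refine Finset.sum_congr rfl fun k _ => ?_
    rw [Finset.sum_comm]
  · rw [Finset.sum_comm]
    trans ∑ l', ∑ l, ∑ k, ∑ u ∈ U, ∑ y ∈ Y, ∑ w ∈ W, f l' l k u w y
    · refine Finset.sum_congr rfl fun l' _ => ?_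
      rw [Finset.sum_comm]
      refine Finset.sum_congr rfl fun l _ => ?_
      rw [Finset.sum_comm]
      refine Finset.sum_congr rfl fun k _ => ?_
      rw [Finset.sum_comm]
    · rw [Finset.sum_comm]

end Reorder

/-! ## §4 The core estimate in canonical order -/

section Core

variable {ι : Type*} [Fintype ι]

/-- [folklore] The constant of an exponential domination is nonnegative. -/
theorem const_nonneg_of_dom {v C κ s : ℝ} (h : |v| ≤ C * Real.exp (-κ * s)) : 0 ≤ C :=
  le_of_mul_le_mul_right (by simpa using (abs_nonneg v).trans h) (Real.exp_pos _)

omit [Fintype ι] in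
/-- [folklore] **MASS STEP**: the sum over the mass variable `q` of `|table| · |leg at q|`, the leg transferred to the vertex location
`u` at the price `e^{κ(r₂/N + D)}`; zero unless the count variable `p` is within range `r₁` of `u`. -/
theorem sum_mass_leg_le (N : ℕ) [NeZero N] (kk : ι → (Fin D → ℤ) → ℝ)
    (T' : ι → (Fin D → ℤ) → (Fin D → ℤ) → (Fin D → ℤ) → ι → ι → ℝ) {κ Ck mT : ℝ} {r₁ r₂ : ℕ} (xk : Fin D → ℤ)
    (hκ : 0 ≤ κ) (hkk : ∀ L' q, |kk L' q| ≤ Ck * Real.exp (-κ * l1 (quo N q - xk)))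
    (hmass : ∀ k u p L L' (Q : Finset (Fin D → ℤ)), ∑ q ∈ Q, |T' k u p q L L'| ≤ mT)
    (hsupp : ∀ k u p q L L', T' k u p q L L' ≠ 0 → l1 (p - u) ≤ r₁ ∧ l1 (q - u) ≤ r₂)
    (k : ι) (u p : Fin D → ℤ) (L L' : ι) (Q : Finset (Fin D → ℤ)) :
    ∑ q ∈ Q, |T' k u p q L L'| * |kk L' q| ≤
      (if l1 (p - u) ≤ (r₁ : ℝ) then (1 : ℝ) else 0) *
        (mT * (Ck * Real.exp (κ * ((r₂ : ℝ) / N + D)) * Real.exp (-κ * l1 (quo N u - xk)))) := by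
  have hCk : 0 ≤ Ck := const_nonneg_of_dom (hkk L' xk)
  set KU : ℝ := Ck * Real.exp (κ * ((r₂ : ℝ) / N + D)) * Real.exp (-κ * l1 (quo N u - xk)) with hKU
  have hKU0 : 0 ≤ KU := by positivity
  -- termwise: |T'| |kk| ≤ |T'| * KU
  have hterm : ∀ q, |T' k u p q L L'| * |kk L' q| ≤ |T' k u p q L L'| * KU := by
    intro q
    by_cases h0 : T' k u p q L L' = 0
    · rw [h0, abs_zero, zero_mul, zero_mul]
    · refine mul_le_mul_of_nonneg_left ?_ (abs_nonneg _)
      have hq := (hsupp k u p q L L' h0).2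
      calc |kk L' q| ≤ Ck * Real.exp (-κ * l1 (quo N q - xk)) := hkk L' q
        _ ≤ Ck * (Real.exp (κ * (l1 (q - u) / N + D)) * Real.exp (-κ * l1 (quo N u - xk))) :=
            mul_le_mul_of_nonneg_left (exp_quo_transfer (N := N) hκ q u xk) hCk
        _ ≤ Ck * (Real.exp (κ * ((r₂ : ℝ) / N + D)) * Real.exp (-κ * l1 (quo N u - xk))) := by
            refine mul_le_mul_of_nonneg_left (mul_le_mul_of_nonneg_right (Real.exp_le_exp.2 ?_) (Real.exp_pos _).le) hCk
            have hN : (0 : ℝ) < N := by exact_mod_cast Nat.pos_of_ne_zero (NeZero.ne N)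
            have : l1 (q - u) / N ≤ (r₂ : ℝ) / N := div_le_div_of_nonneg_right hq hN.le
            nlinarith
        _ = KU := by rw [hKU]; ring
  by_cases hp : l1 (p - u) ≤ (r₁ : ℝ)
  · rw [if_pos hp, one_mul]
    calc ∑ q ∈ Q, |T' k u p q L L'| * |kk L' q| ≤ ∑ q ∈ Q, |T' k u p q L L'| * KU := Finset.sum_le_sum fun q _ => hterm q
      _ = (∑ q ∈ Q, |T' k u p q L L'|) * KU := by rw [Finset.sum_mul]
      _ ≤ mT * KU := mul_le_mul_of_nonneg_right (hmass k u p L L' Q) hKU0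
  · rw [if_neg hp, zero_mul]
    refine le_of_eq (Finset.sum_eq_zero fun q _ => ?_)
    have h0 : T' k u p q L L' = 0 := by
      by_contra hne
      exact hp (hsupp k u p q L L' hne).1
    rw [h0, abs_zero, zero_mul]

omit [Fintype ι] in
/-- [folklore] **COUNT STEP**: the count-variable leg, restricted to the range `r₁` of `u` and transferred to `u`, summed over any finite
set: `≤ Ca · e^{κ(r₁/N + D)} · e^{−κ|quo u − xa|₁} · (2r₁+1)^D`. -/
theorem sum_count_leg_le (N : ℕ) [NeZero N] (a : ι → (Fin D → ℤ) → ℝ) {κ Ca : ℝ} {r₁ : ℕ} (xa : Fin D → ℤ)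
    (hκ : 0 ≤ κ) (ha : ∀ L p, |a L p| ≤ Ca * Real.exp (-κ * l1 (quo N p - xa)))
    (u : Fin D → ℤ) (L : ι) (P : Finset (Fin D → ℤ)) :
    ∑ p ∈ P, |a L p| * (if l1 (p - u) ≤ (r₁ : ℝ) then (1 : ℝ) else 0) ≤
      Ca * Real.exp (κ * ((r₁ : ℝ) / N + D)) * Real.exp (-κ * l1 (quo N u - xa)) * (2 * r₁ + 1 : ℝ) ^ D := by
  have hCa : 0 ≤ Ca := const_nonneg_of_dom (ha L xa)
  set AU : ℝ := Ca * Real.exp (κ * ((r₁ : ℝ) / N + D)) * Real.exp (-κ * l1 (quo N u - xa)) with hAU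
  have hAU0 : 0 ≤ AU := by positivity
  have hterm : ∀ p, |a L p| * (if l1 (p - u) ≤ (r₁ : ℝ) then (1 : ℝ) else 0) ≤
      (if l1 (p - u) ≤ (r₁ : ℝ) then (1 : ℝ) else 0) * AU := by
    intro p
    by_cases hp : l1 (p - u) ≤ (r₁ : ℝ)
    · rw [if_pos hp, mul_one, one_mul]
      calc |a L p| ≤ Ca * Real.exp (-κ * l1 (quo N p - xa)) := ha L p
        _ ≤ Ca * (Real.exp (κ * (l1 (p - u) / N + D)) * Real.exp (-κ * l1 (quo N u - xa))) :=
            mul_le_mul_of_nonneg_left (exp_quo_transfer (N := N) hκ p u xa) hCa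
        _ ≤ Ca * (Real.exp (κ * ((r₁ : ℝ) / N + D)) * Real.exp (-κ * l1 (quo N u - xa))) := by
            refine mul_le_mul_of_nonneg_left (mul_le_mul_of_nonneg_right (Real.exp_le_exp.2 ?_) (Real.exp_pos _).le) hCa
            have hN : (0 : ℝ) < N := by exact_mod_cast Nat.pos_of_ne_zero (NeZero.ne N)
            have : l1 (p - u) / N ≤ (r₁ : ℝ) / N := div_le_div_of_nonneg_right hp hN.le
            nlinarith
        _ = AU := by rw [hAU]; ring
    · rw [if_neg hp, mul_zero, zero_mul]
  calc ∑ p ∈ P, |a L p| * (if l1 (p - u) ≤ (r₁ : ℝ) then (1 : ℝ) else 0)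
      ≤ ∑ p ∈ P, (if l1 (p - u) ≤ (r₁ : ℝ) then (1 : ℝ) else 0) * AU := Finset.sum_le_sum fun p _ => hterm p
    _ = (∑ p ∈ P, (if l1 (p - u) ≤ (r₁ : ℝ) then (1 : ℝ) else 0)) * AU := by rw [Finset.sum_mul]
    _ = ((P.filter fun p => l1 (p - u) ≤ (r₁ : ℝ)).card : ℝ) * AU := by rw [Finset.sum_boole]
    _ ≤ (2 * r₁ + 1 : ℝ) ^ D * AU := mul_le_mul_of_nonneg_right (card_filter_l1_le P u r₁) hAU0
    _ = _ := by rw [hAU]; ring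

/-- [folklore] **THE CORE ESTIMATE** (canonical order `(L′, L, k, u, p, q)`, count variable `p`, mass variable `q`): three block-decaying legs,
a finite-mass finite-range table, the block average over the vertex location `u` — `≤ (#ι)³ · Ca·CB·Ck·mT · (2r₁+1)^D · e^{κ((r₁+r₂)/N + 2D)} ·
Zl_D(κ/2) · e^{−(κ/2)(|xa − u′|₁ + |xk − u′|₁)}`, uniformly in the finite site sets. -/
theorem core_bound [Nonempty ι] (N : ℕ) [NeZero N] (a B kk : ι → (Fin D → ℤ) → ℝ)
    (T' : ι → (Fin D → ℤ) → (Fin D → ℤ) → (Fin D → ℤ) → ι → ι → ℝ)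
    {κ Ca CB Ck mT : ℝ} {r₁ r₂ : ℕ} (xa u' xk : Fin D → ℤ) (hκ : 0 < κ)
    (ha : ∀ L p, |a L p| ≤ Ca * Real.exp (-κ * l1 (quo N p - xa)))
    (hB : ∀ k u, |B k u| ≤ CB * Real.exp (-κ * l1 (quo N u - u')))
    (hkk : ∀ L' q, |kk L' q| ≤ Ck * Real.exp (-κ * l1 (quo N q - xk)))
    (hmass : ∀ k u p L L' (Q : Finset (Fin D → ℤ)), ∑ q ∈ Q, |T' k u p q L L'| ≤ mT)
    (hsupp : ∀ k u p q L L', T' k u p q L L' ≠ 0 → l1 (p - u) ≤ r₁ ∧ l1 (q - u) ≤ r₂)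
    (U P Q : Finset (Fin D → ℤ)) :
    ∑ L', ∑ L, ∑ k, ∑ u ∈ U, ∑ p ∈ P, ∑ q ∈ Q, |a L p| * (((N : ℝ) ^ D)⁻¹ * (|B k u| * |T' k u p q L L'|)) * |kk L' q| ≤
      (Fintype.card ι : ℝ) ^ 3 * (Ca * CB * Ck * mT) * (2 * r₁ + 1 : ℝ) ^ D *
        Real.exp (κ * (((r₁ : ℝ) + r₂) / N + 2 * D)) *
          (Zl D (κ / 2) * Real.exp (-(κ / 2) * (l1 (xa - u') + l1 (xk - u')))) := by
  have hCa : 0 ≤ Ca := const_nonneg_of_dom (ha (Classical.arbitrary ι) xa)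
  have hCB : 0 ≤ CB := const_nonneg_of_dom (hB (Classical.arbitrary ι) u')
  have hCk : 0 ≤ Ck := const_nonneg_of_dom (hkk (Classical.arbitrary ι) xk)
  have hmT : 0 ≤ mT := le_trans (by simp) (hmass (Classical.arbitrary ι) u' u' (Classical.arbitrary ι) (Classical.arbitrary ι) ∅)
  set c : ℝ := ((N : ℝ) ^ D)⁻¹ with hc
  have hc0 : 0 ≤ c := by positivity
  set e₁ : ℝ := Real.exp (κ * ((r₁ : ℝ) / N + D)) with he₁
  set e₂ : ℝ := Real.exp (κ * ((r₂ : ℝ) / N + D)) with he₂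
  set Ea : (Fin D → ℤ) → ℝ := fun u => Real.exp (-κ * l1 (quo N u - xa)) with hEa
  set Eb : (Fin D → ℤ) → ℝ := fun u => Real.exp (-κ * l1 (quo N u - u')) with hEb
  set Ek : (Fin D → ℤ) → ℝ := fun u => Real.exp (-κ * l1 (quo N u - xk)) with hEk
  -- the two inner levels
  have hinner : ∀ L' L k u, ∑ p ∈ P, ∑ q ∈ Q, |a L p| * (c * (|B k u| * |T' k u p q L L'|)) * |kk L' q| ≤
      c * |B k u| * ((Ca * e₁ * Ea u * (2 * r₁ + 1 : ℝ) ^ D) * (mT * (Ck * e₂ * Ek u))) := by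
    intro L' L k u
    have hq := sum_mass_leg_le (ι := ι) N kk T' xk hκ.le hkk hmass hsupp k u
    have e : ∀ p, ∑ q ∈ Q, |a L p| * (c * (|B k u| * |T' k u p q L L'|)) * |kk L' q| =
        (c * |B k u|) * (|a L p| * ∑ q ∈ Q, |T' k u p q L L'| * |kk L' q|) := by
      intro p
      rw [Finset.mul_sum, Finset.mul_sum]
      exact Finset.sum_congr rfl fun q _ => by ring
    simp_rw [e]
    rw [← Finset.mul_sum]
    refine mul_le_mul_of_nonneg_left ?_ (mul_nonneg hc0 (abs_nonneg _))
    calc ∑ p ∈ P, |a L p| * ∑ q ∈ Q, |T' k u p q L L'| * |kk L' q|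
        ≤ ∑ p ∈ P, |a L p| * ((if l1 (p - u) ≤ (r₁ : ℝ) then (1 : ℝ) else 0) * (mT * (Ck * e₂ * Ek u))) :=
          Finset.sum_le_sum fun p _ => mul_le_mul_of_nonneg_left (hq p L L' Q) (abs_nonneg _)
      _ = (∑ p ∈ P, |a L p| * (if l1 (p - u) ≤ (r₁ : ℝ) then (1 : ℝ) else 0)) * (mT * (Ck * e₂ * Ek u)) := by
          rw [Finset.sum_mul]; exact Finset.sum_congr rfl fun p _ => by ring
      _ ≤ (Ca * e₁ * Ea u * (2 * r₁ + 1 : ℝ) ^ D) * (mT * (Ck * e₂ * Ek u)) :=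
          mul_le_mul_of_nonneg_right (sum_count_leg_le (ι := ι) N a xa hκ.le ha u L P) (by positivity)
  -- the `u` level: the block sum with three legs
  have hblock : ∑ u ∈ U, c * (Ea u * Eb u * Ek u) ≤ Zl D (κ / 2) * Real.exp (-(κ / 2) * (l1 (xa - u') + l1 (xk - u'))) := by
    have hs := summable_blockSum_exp (N := N) (D := D) hκ xa u' xk
    have e : ∀ u, c * (Ea u * Eb u * Ek u) =
        ((N : ℝ) ^ D)⁻¹ * Real.exp (-κ * (l1 (quo N u - xa) + l1 (quo N u - u') + l1 (quo N u - xk))) := by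
      intro u
      rw [show -κ * (l1 (quo N u - xa) + l1 (quo N u - u') + l1 (quo N u - xk)) =
          -κ * l1 (quo N u - xa) + -κ * l1 (quo N u - u') + -κ * l1 (quo N u - xk) by ring, Real.exp_add, Real.exp_add]
    simp_rw [e]
    exact (hs.sum_le_tsum U (fun u _ => by positivity)).trans (blockSum_exp_le (N := N) hκ xa u' xk)
  have hu : ∀ L' L k, ∑ u ∈ U, ∑ p ∈ P, ∑ q ∈ Q, |a L p| * (c * (|B k u| * |T' k u p q L L'|)) * |kk L' q| ≤
      (Ca * CB * Ck * mT) * (2 * r₁ + 1 : ℝ) ^ D * (e₁ * e₂) *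
        (Zl D (κ / 2) * Real.exp (-(κ / 2) * (l1 (xa - u') + l1 (xk - u')))) := by
    intro L' L k
    calc ∑ u ∈ U, ∑ p ∈ P, ∑ q ∈ Q, |a L p| * (c * (|B k u| * |T' k u p q L L'|)) * |kk L' q|
        ≤ ∑ u ∈ U, c * |B k u| * ((Ca * e₁ * Ea u * (2 * r₁ + 1 : ℝ) ^ D) * (mT * (Ck * e₂ * Ek u))) :=
          Finset.sum_le_sum fun u _ => hinner L' L k u
      _ ≤ ∑ u ∈ U, c * (CB * Eb u) * ((Ca * e₁ * Ea u * (2 * r₁ + 1 : ℝ) ^ D) * (mT * (Ck * e₂ * Ek u))) :=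
          Finset.sum_le_sum fun u _ => mul_le_mul_of_nonneg_right
            (mul_le_mul_of_nonneg_left (hB k u) hc0) (by positivity)
      _ = (Ca * CB * Ck * mT) * (2 * r₁ + 1 : ℝ) ^ D * (e₁ * e₂) * ∑ u ∈ U, c * (Ea u * Eb u * Ek u) := by
          rw [Finset.mul_sum]; exact Finset.sum_congr rfl fun u _ => by ring
      _ ≤ _ := mul_le_mul_of_nonneg_left hblock (by positivity)
  have he : e₁ * e₂ = Real.exp (κ * (((r₁ : ℝ) + r₂) / N + 2 * D)) := by
    rw [he₁, he₂, ← Real.exp_add]; congr 1; ring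
  calc ∑ L', ∑ L, ∑ k, ∑ u ∈ U, ∑ p ∈ P, ∑ q ∈ Q, |a L p| * (c * (|B k u| * |T' k u p q L L'|)) * |kk L' q|
      ≤ ∑ L' : ι, ∑ L : ι, ∑ k : ι, (Ca * CB * Ck * mT) * (2 * r₁ + 1 : ℝ) ^ D * (e₁ * e₂) *
          (Zl D (κ / 2) * Real.exp (-(κ / 2) * (l1 (xa - u') + l1 (xk - u')))) :=
        Finset.sum_le_sum fun L' _ => Finset.sum_le_sum fun L _ => Finset.sum_le_sum fun k _ => hu L' L k
    _ = _ := by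
        simp only [Finset.sum_const, Finset.card_univ, nsmul_eq_mul, he]
        ring

end Core


/-! ## §5 THE OFF-DIAGONAL SANDWICH LEMMA (two versions: mass on the outer site `y`, mass on the inner site `w`) -/

section Sandwich

variable {ι : Type*} [Fintype ι] [Nonempty ι]

/-- **OFF-DIAGONAL SANDWICH, MASS ON THE OUTER SITE** [folklore].  The literally nested one-channel unit sandwich
`Σ'_y Σ_{l′} (Σ'_w Σ_l A_l(w) · Σ_k c · Σ'_u B_k(u) · T_k(u; w, y)_{l l′}) · K_{l′}(y)`, `c = N^{−D}`, with three legs decaying on the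
BLOCK scale (`|A_l(w)| ≤ Ca e^{−κ|quo_N w − xA|₁}`, `|B_k(u)| ≤ CB e^{−κ|quo_N u − u′|₁}`, `|K_{l′}(y)| ≤ Ck e^{−κ|quo_N y − xK|₁}`) and a
table of finite `y`-MASS `mT` (at every `(k, u, w, l, l′)`, over every finite set) and finite `ℓ¹`-RANGE (`r₁` in `w − u`, `r₂` in
`y − u`), is bounded by
`(#ι)³ · Ca·CB·Ck·mT · (2r₁+1)^D · e^{κ((r₁+r₂)/N + 2D)} · Zl_D(κ/2) · e^{−(κ/2)(|xA − u′|₁ + |xK − u′|₁)}`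
— the `BiLoc … u′ u′ _ (κ/2)` shape in the read-out points, with the blocking `N` entering ONLY through `(r₁+r₂)/N`. -/
theorem abs_channel_le_col (N : ℕ) [NeZero N] (A B K : ι → (Fin D → ℤ) → ℝ)
    (T : ι → (Fin D → ℤ) → (Fin D → ℤ) → (Fin D → ℤ) → ι → ι → ℝ) (c : ℝ) (hc : c = ((N : ℝ) ^ D)⁻¹)
    {κ Ca CB Ck mT : ℝ} {r₁ r₂ : ℕ} (xA u' xK : Fin D → ℤ) (hκ : 0 < κ)
    (hA : ∀ l w, |A l w| ≤ Ca * Real.exp (-κ * l1 (quo N w - xA)))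
    (hB : ∀ k u, |B k u| ≤ CB * Real.exp (-κ * l1 (quo N u - u')))
    (hK : ∀ l' y, |K l' y| ≤ Ck * Real.exp (-κ * l1 (quo N y - xK)))
    (hTm : ∀ k u w l l' (Y : Finset (Fin D → ℤ)), ∑ y ∈ Y, |T k u w y l l'| ≤ mT)
    (hTs : ∀ k u w y l l', T k u w y l l' ≠ 0 → l1 (w - u) ≤ r₁ ∧ l1 (y - u) ≤ r₂) :
    |∑' y, ∑ l', (∑' w, ∑ l, A l w * ∑ k, c * ∑' u, B k u * T k u w y l l') * K l' y| ≤
      (Fintype.card ι : ℝ) ^ 3 * (Ca * CB * Ck * mT) * (2 * r₁ + 1 : ℝ) ^ D *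
        Real.exp (κ * (((r₁ : ℝ) + r₂) / N + 2 * D)) *
          (Zl D (κ / 2) * Real.exp (-(κ / 2) * (l1 (xA - u') + l1 (xK - u')))) := by
  subst hc
  refine abs_channel_le_of_finset_bound A B K T _ (by positivity) hTs fun U W Y => ?_
  exact (reorder_col U W Y _).trans_le (core_bound N A B K T xA u' xK hκ hA hB hK hTm hTs U W Y)

/-- **OFF-DIAGONAL SANDWICH, MASS ON THE INNER SITE** [folklore] (the mirror block: the table has finite `w`-MASS at every
`(k, u, y, l, l′)` and ranges `r₂` in `w − u`, `r₁` in `y − u`; the count runs over `y`). Same bound with the roles of the two outer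
legs exchanged. -/
theorem abs_channel_le_row (N : ℕ) [NeZero N] (A B K : ι → (Fin D → ℤ) → ℝ)
    (T : ι → (Fin D → ℤ) → (Fin D → ℤ) → (Fin D → ℤ) → ι → ι → ℝ) (c : ℝ) (hc : c = ((N : ℝ) ^ D)⁻¹)
    {κ Ca CB Ck mT : ℝ} {r₁ r₂ : ℕ} (xA u' xK : Fin D → ℤ) (hκ : 0 < κ)
    (hA : ∀ l w, |A l w| ≤ Ca * Real.exp (-κ * l1 (quo N w - xA)))
    (hB : ∀ k u, |B k u| ≤ CB * Real.exp (-κ * l1 (quo N u - u')))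
    (hK : ∀ l' y, |K l' y| ≤ Ck * Real.exp (-κ * l1 (quo N y - xK)))
    (hTm : ∀ k u y l l' (W : Finset (Fin D → ℤ)), ∑ w ∈ W, |T k u w y l l'| ≤ mT)
    (hTs : ∀ k u w y l l', T k u w y l l' ≠ 0 → l1 (w - u) ≤ r₂ ∧ l1 (y - u) ≤ r₁) :
    |∑' y, ∑ l', (∑' w, ∑ l, A l w * ∑ k, c * ∑' u, B k u * T k u w y l l') * K l' y| ≤
      (Fintype.card ι : ℝ) ^ 3 * (Ck * CB * Ca * mT) * (2 * r₁ + 1 : ℝ) ^ D *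
        Real.exp (κ * (((r₁ : ℝ) + r₂) / N + 2 * D)) *
          (Zl D (κ / 2) * Real.exp (-(κ / 2) * (l1 (xK - u') + l1 (xA - u')))) := by
  subst hc
  refine abs_channel_le_of_finset_bound A B K T _ (by positivity) hTs fun U W Y => ?_
  have hswap : ∑ y ∈ Y, ∑ l', ∑ w ∈ W, ∑ l, ∑ k, ∑ u ∈ U,
      |A l w| * (((N : ℝ) ^ D)⁻¹ * (|B k u| * |T k u w y l l'|)) * |K l' y| =
      ∑ y ∈ Y, ∑ l', ∑ w ∈ W, ∑ l, ∑ k, ∑ u ∈ U,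
        |K l' y| * (((N : ℝ) ^ D)⁻¹ * (|B k u| * |T k u w y l l'|)) * |A l w| :=
    Finset.sum_congr rfl fun _ _ => Finset.sum_congr rfl fun _ _ => Finset.sum_congr rfl fun _ _ =>
      Finset.sum_congr rfl fun _ _ => Finset.sum_congr rfl fun _ _ => Finset.sum_congr rfl fun _ _ => by ring
  rw [hswap]
  exact (reorder_row U W Y fun l' l k u w y => |K l' y| * (((N : ℝ) ^ D)⁻¹ * (|B k u| * |T k u w y l l'|)) * |A l w|).trans_le
    (core_bound N K B A (fun k u p q L L' => T k u q p L' L) xK u' xA hκ hK hB hA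
      (fun k u p L L' Q => hTm k u p L' L Q) (fun k u p q L L' h => (hTs k u q p L' L h).symm) U Y W)

end Sandwich

end Summit.QuantumFields.BalabanUV.Beta.GAN24.OffDiagSandwich

end
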